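import Mathlib
import Summits.ResolutionOfSingularities.ResolutionOfSingularities.Theorems.HomologicalConductorPersistenceFaithfullyFlatDescent
import HarnessLib

set_option linter.dupNamespace false

/-!
# Hom out of a finitely presented module commutes with flat base change

`[OURS · L1 w44b · ORDER w44b-o8b AMENDMENT (res-L1-w44b-plan-1 gen 10, 07:20:42Z) · brick (H) for
(D0)/(D4)]` — helper for the surface rung `PersistenceSurface` (stmt-ResolutionOfSingularities-19970)
of the crux `HomologicalConductor.Persistence` (stmt-ResolutionOfSingularities-16484).  NOT a
statement of the manuscript under adjudication in cell res-hironaka; nothing here is attributed to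
its author.  Pure commutative algebra filling a Mathlib gap: Mathlib's
`IsBaseChange.linearMapLeftRight` gives `S ⊗_T Hom_T(F, N) ≅ Hom_S(S ⊗ F, S ⊗ N)` only for `F`
finite FREE; here the source is finitely PRESENTED and `S` is FLAT.

* **(H0)** `exact_lcomp_of_exact_of_surjective` — `Hom_T(−, N)` is left exact on a right exact
  sequence `F₁ →ρ F₀ →π L → 0`: `0 → Hom(L,N) →π* Hom(F₀,N) →ρ* Hom(F₁,N)` is exact
  (`lcomp_injective_of_surjective` for the first map).
* **(H1)** `exists_fin_presentation` — a finitely presented module has a presentation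
  `(Fin k → T) →ρ (Fin n → T) →π L → 0`.
* **(H2)** `bijective_liftBaseChange_of_isBaseChange` / `isBaseChange_of_bijective_liftBaseChange` —
  `IsBaseChange S φ` is the bijectivity of `φ.liftBaseChange S : S ⊗_T V → W`;
  `isBaseChange_baseChangeHom_of_free` — the finite free case, read off Mathlib.
* **(H3)** `isBaseChange_baseChangeHom` — for `S` flat over `T`, `L` finitely presented and any `N`:
  `IsBaseChange S (LinearMap.baseChangeHom T S L N)`, i.e. the `S`-linear map
  `S ⊗_T Hom_T(L, N) → Hom_S(S ⊗_T L, S ⊗_T N)`, `s ⊗ f ↦ s • (f ⊗ S)`, is bijective (diagram chase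
  on the two exact rows of (H0), tensored with flat `S` resp. taken over `S`, the outer vertical
  maps being the free case (H2)).
* **(H4)** `mem_span_range_baseChange` — consequently every `S`-linear map `S ⊗ L → S ⊗ N` is an
  `S`-linear combination of base changes `i ⊗ S` of `T`-linear maps `i : L → N`;
  `baseChange_injective` — and `i ↦ i ⊗ S` is injective on `Hom_T(L, N)` as soon as
  `Hom_T(L,N) → S ⊗ Hom_T(L,N)` is (e.g. `S` faithfully flat).

## References

* N. Bourbaki, *Algèbre commutative* I §2.10 Prop. 11 / The Stacks project, Tag 0583 («Hom from a
  finitely presented module commutes with flat base change») — folklore; Lean proof from Mathlib's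
  free case `IsBaseChange.linearMapLeftRight`.
-/

noncomputable section

open scoped TensorProduct

universe u

namespace Summit.ResolutionOfSingularities.ResolutionOfSingularities.Theorems.HomologicalConductor.PersistenceFlatHomBaseChange

open Summit.ResolutionOfSingularities.ResolutionOfSingularities.Theorems.HomologicalConductor.PersistenceFaithfullyFlatDescent

variable {T : Type u} [CommRing T] (S : Type u) [CommRing S] [Algebra T S]

/-! ## (H0) Left exactness of `Hom(−, N)` on a presentation -/

/-- Precomposition with a surjection is injective on linear maps. [folklore] -/
theorem lcomp_injective_of_surjective {F₀ L N : Type u} [AddCommGroup F₀] [Module T F₀]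
    [AddCommGroup L] [Module T L] [AddCommGroup N] [Module T N] (π : F₀ →ₗ[T] L)
    (hπ : Function.Surjective π) : Function.Injective (LinearMap.lcomp T N π) := by
  intro f g h
  rw [LinearMap.lcomp_apply', LinearMap.lcomp_apply'] at h
  exact (LinearMap.cancel_right hπ).mp h

/-- **`Hom(−, N)` is left exact**: for `F₁ →ρ F₀ →π L → 0` exact (`Function.Exact ρ π`, `π`
surjective) and any `N`, the sequence `Hom(L,N) →π* Hom(F₀,N) →ρ* Hom(F₁,N)` is exact at
`Hom(F₀,N)`: a map killing `range ρ = ker π` factors through `π`. [folklore] -/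
theorem exact_lcomp_of_exact_of_surjective {F₁ F₀ L N : Type u} [AddCommGroup F₁] [Module T F₁]
    [AddCommGroup F₀] [Module T F₀] [AddCommGroup L] [Module T L] [AddCommGroup N] [Module T N]
    (ρ : F₁ →ₗ[T] F₀) (π : F₀ →ₗ[T] L) (hex : Function.Exact ρ π)
    (hπ : Function.Surjective π) :
    Function.Exact (LinearMap.lcomp T N π) (LinearMap.lcomp T N ρ) := by
  intro f
  constructor
  · intro hf
    rw [LinearMap.lcomp_apply'] at hf
    have hker : LinearMap.ker π ≤ LinearMap.ker f := by
      rw [hex.linearMap_ker_eq]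
      rintro _ ⟨w, rfl⟩
      rw [LinearMap.mem_ker, ← LinearMap.comp_apply, hf, LinearMap.zero_apply]
    refine ⟨(LinearMap.ker π).liftQ f hker ∘ₗ (π.quotKerEquivOfSurjective hπ).symm.toLinearMap, ?_⟩
    rw [LinearMap.lcomp_apply']
    ext v
    simp only [LinearMap.coe_comp, Function.comp_apply, LinearEquiv.coe_coe,
      LinearMap.quotKerEquivOfSurjective_symm_apply, Submodule.liftQ_apply]
  · rintro ⟨g, rfl⟩
    rw [LinearMap.lcomp_apply', LinearMap.lcomp_apply', LinearMap.comp_assoc,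
      hex.linearMap_comp_eq_zero, LinearMap.comp_zero]

/-! ## (H1) Finite presentations -/

/-- A finitely presented module `L` has a presentation `(Fin k → T) →ρ (Fin n → T) →π L → 0`
(`ρ`, `π` exact, `π` surjective). [folklore; Mathlib `Module.FinitePresentation.exists_fin`] -/
theorem exists_fin_presentation (L : Type u) [AddCommGroup L] [Module T L]
    [Module.FinitePresentation T L] :
    ∃ (n k : ℕ) (ρ : (Fin k → T) →ₗ[T] (Fin n → T)) (π : (Fin n → T) →ₗ[T] L),
      Function.Exact ρ π ∧ Function.Surjective π := by
  obtain ⟨n, K, e, hK⟩ := Module.FinitePresentation.exists_fin T L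
  haveI : Module.Finite T K := Module.Finite.iff_fg.mpr hK
  obtain ⟨k, f, hf⟩ := Module.Finite.exists_fin' T K
  refine ⟨n, k, K.subtype ∘ₗ f, (e.symm : ((Fin n → T) ⧸ K) →ₗ[T] L) ∘ₗ K.mkQ, ?_,
    e.symm.surjective.comp K.mkQ_surjective⟩
  rw [LinearMap.exact_iff, LinearEquiv.ker_comp, Submodule.ker_mkQ, LinearMap.range_comp,
    LinearMap.range_eq_top.mpr hf, Submodule.map_top, Submodule.range_subtype]

/-! ## (H2) `IsBaseChange` versus bijectivity of `liftBaseChange`; the free case -/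

/-- If `φ : V → W` exhibits `W` as the base change of `V`, then `φ.liftBaseChange S : S ⊗ V → W`
(`s ⊗ v ↦ s • φ v`) is bijective — it IS the structure isomorphism `IsBaseChange.equiv`.  (Stated
over additive monoids, the generality of Mathlib's `IsBaseChange`, so that it unifies cheaply with
instances synthesized on Hom-modules.) [folklore] -/
theorem bijective_liftBaseChange_of_isBaseChange {V W : Type u} [AddCommMonoid V] [Module T V]
    [AddCommMonoid W] [Module T W] [Module S W] [IsScalarTower T S W] {φ : V →ₗ[T] W}
    (h : IsBaseChange S φ) : Function.Bijective (φ.liftBaseChange S) := by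
  have hθ : φ.liftBaseChange S = h.equiv.toLinearMap :=
    (TensorProduct.isBaseChange T V S).algHom_ext _ _ fun v => by
      rw [TensorProduct.mk_apply, LinearMap.liftBaseChange_tmul, LinearEquiv.coe_coe,
        IsBaseChange.equiv_tmul]
  rw [hθ]
  exact h.equiv.bijective

/-- Conversely, if `φ.liftBaseChange S : S ⊗ V → W` is bijective then `φ` is a base change.
[folklore] -/
theorem isBaseChange_of_bijective_liftBaseChange {V W : Type u} [AddCommMonoid V] [Module T V]
    [AddCommMonoid W] [Module T W] [Module S W] [IsScalarTower T S W] {φ : V →ₗ[T] W}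
    (h : Function.Bijective (φ.liftBaseChange S)) : IsBaseChange S φ :=
  IsBaseChange.of_equiv (LinearEquiv.ofBijective (φ.liftBaseChange S) h) fun v => by
    rw [LinearEquiv.ofBijective_apply, LinearMap.liftBaseChange_tmul, one_smul]

/-- **The finite free case** (Mathlib `IsBaseChange.linearMapLeftRight`, restated for
`LinearMap.baseChangeHom`): for `F` finite free over `T` and any `N`,
`S ⊗_T Hom_T(F, N) ≅ Hom_S(S ⊗ F, S ⊗ N)` via `s ⊗ f ↦ s • (f ⊗ S)`. [folklore] -/
theorem isBaseChange_baseChangeHom_of_free (F N : Type u) [AddCommGroup F] [Module T F]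
    [Module.Free T F] [Module.Finite T F] [AddCommGroup N] [Module T N] :
    IsBaseChange S (LinearMap.baseChangeHom T S F N) := by
  have h : LinearMap.baseChangeHom T S F N =
      IsBaseChange.linearMapLeftRightHom (TensorProduct.isBaseChange T F S)
        (TensorProduct.mk T S N 1) := by
    ext f : 1
    rw [LinearMap.baseChangeHom_apply, linearMapLeftRightHom_mk_eq_baseChange]
  rw [h]
  exact IsBaseChange.linearMapLeftRight _ (TensorProduct.isBaseChange T N S)

/-! ## (H3) The finitely presented case -/

/-- Compatibility of `s ⊗ f ↦ s • (f ⊗ S)` with precomposition: for `π : F₀ → L` and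
`u ∈ S ⊗ Hom(L, N)`, `θ_{F₀} ((π* ⊗ S) u) = θ_L(u) ∘ (π ⊗ S)`. [folklore] -/
theorem liftBaseChange_baseChangeHom_lcomp {F₀ L N : Type u} [AddCommGroup F₀] [Module T F₀]
    [AddCommGroup L] [Module T L] [AddCommGroup N] [Module T N] (π : F₀ →ₗ[T] L)
    (u : S ⊗[T] (L →ₗ[T] N)) :
    (LinearMap.baseChangeHom T S F₀ N).liftBaseChange S ((LinearMap.lcomp T N π).baseChange S u) =
      (LinearMap.baseChangeHom T S L N).liftBaseChange S u ∘ₗ π.baseChange S := by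
  induction u using TensorProduct.induction_on with
  | zero => simp only [map_zero, LinearMap.zero_comp]
  | add u₁ u₂ h₁ h₂ => simp only [map_add, h₁, h₂, LinearMap.add_comp]
  | tmul s f =>
    rw [LinearMap.baseChange_tmul, LinearMap.liftBaseChange_tmul, LinearMap.liftBaseChange_tmul,
      LinearMap.baseChangeHom_apply, LinearMap.baseChangeHom_apply, LinearMap.lcomp_apply',
      LinearMap.baseChange_comp, LinearMap.smul_comp]

/-- **Hom out of a finitely presented module commutes with flat base change.**  For `S` flat over
`T`, `L` a finitely presented `T`-module and `N` any `T`-module, the natural `S`-linear map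
`S ⊗_T Hom_T(L, N) → Hom_S(S ⊗_T L, S ⊗_T N)`, `s ⊗ f ↦ s • (f ⊗ S)`, is an isomorphism, i.e.
`IsBaseChange S (LinearMap.baseChangeHom T S L N)`.  Proof: choose `F₁ →ρ F₀ →π L → 0` with
`Fᵢ` finite free; the rows `0 → S ⊗ Hom(L,N) → S ⊗ Hom(F₀,N) → S ⊗ Hom(F₁,N)` (flatness) and
`0 → Hom_S(S⊗L, S⊗N) → Hom_S(S⊗F₀, S⊗N) → Hom_S(S⊗F₁, S⊗N)` (right exactness of `S ⊗ −`, left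
exactness of Hom) are exact, the vertical maps at `F₀`, `F₁` are isomorphisms (free case), and a
diagram chase gives the claim at `L` (The Stacks project, Tag 0583; Bourbaki, AC I §2.10
Prop. 11). [folklore] -/
theorem isBaseChange_baseChangeHom [Module.Flat T S] (L N : Type u) [AddCommGroup L] [Module T L]
    [Module.FinitePresentation T L] [AddCommGroup N] [Module T N] :
    IsBaseChange S (LinearMap.baseChangeHom T S L N) := by
  obtain ⟨n, k, ρ, π, hex, hπ⟩ := exists_fin_presentation (T := T) L
  -- the comparison maps at the two free terms are bijective
  have hθ₀b : Function.Bijective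
      ((LinearMap.baseChangeHom T S (Fin n → T) N).liftBaseChange S) :=
    bijective_liftBaseChange_of_isBaseChange S (isBaseChange_baseChangeHom_of_free S _ N)
  have hθ₁b : Function.Bijective
      ((LinearMap.baseChangeHom T S (Fin k → T) N).liftBaseChange S) :=
    bijective_liftBaseChange_of_isBaseChange S (isBaseChange_baseChangeHom_of_free S _ N)
  -- top row: `Hom(L,N) → Hom(F₀,N) → Hom(F₁,N)` tensored with flat `S`
  have hexT : Function.Exact ((LinearMap.lcomp T N π).baseChange S)
      ((LinearMap.lcomp T N ρ).baseChange S) := by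
    rw [LinearMap.baseChange_eq_ltensor, LinearMap.baseChange_eq_ltensor]
    exact Module.Flat.lTensor_exact S (exact_lcomp_of_exact_of_surjective ρ π hex hπ)
  have hinjT : Function.Injective ((LinearMap.lcomp T N π).baseChange S) := by
    rw [LinearMap.baseChange_eq_ltensor]
    exact Module.Flat.lTensor_preserves_injective_linearMap _ (lcomp_injective_of_surjective π hπ)
  -- bottom row: the base-changed presentation over `S`
  have hexS : Function.Exact (ρ.baseChange S) (π.baseChange S) := by
    rw [LinearMap.baseChange_eq_ltensor, LinearMap.baseChange_eq_ltensor]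
    exact lTensor_exact S hex hπ
  have hπS : Function.Surjective (π.baseChange S) := by
    rw [LinearMap.baseChange_eq_ltensor]
    exact LinearMap.lTensor_surjective S hπ
  -- the squares
  have hsq₀ := liftBaseChange_baseChangeHom_lcomp S (N := N) π
  have hsq₁ := liftBaseChange_baseChangeHom_lcomp S (N := N) ρ
  refine isBaseChange_of_bijective_liftBaseChange S ⟨?_, ?_⟩
  · -- injectivity
    rw [injective_iff_map_eq_zero]
    intro u hu
    have h0 : (LinearMap.baseChangeHom T S (Fin n → T) N).liftBaseChange S
        ((LinearMap.lcomp T N π).baseChange S u) = 0 := by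
      rw [hsq₀, hu, LinearMap.zero_comp]
    rw [← map_zero ((LinearMap.baseChangeHom T S (Fin n → T) N).liftBaseChange S)] at h0
    exact hinjT ((hθ₀b.1 h0).trans (map_zero _).symm)
  · -- surjectivity
    intro g
    obtain ⟨v, hv⟩ := hθ₀b.2 (g ∘ₗ π.baseChange S)
    have h1 : (LinearMap.lcomp T N ρ).baseChange S v = 0 := by
      apply hθ₁b.1
      rw [hsq₁, hv, map_zero, LinearMap.comp_assoc, hexS.linearMap_comp_eq_zero,
        LinearMap.comp_zero]
    obtain ⟨u, hu⟩ := (hexT v).mp h1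
    refine ⟨u, ?_⟩
    rw [← LinearMap.cancel_right hπS, ← hsq₀, hu, hv]

/-- The structure isomorphism of (H3) on elementary tensors:
`(isBaseChange_baseChangeHom …).equiv (s ⊗ f) = s • (f ⊗ S)`. [folklore] -/
theorem isBaseChange_baseChangeHom_equiv_tmul [Module.Flat T S] (L N : Type u) [AddCommGroup L]
    [Module T L] [Module.FinitePresentation T L] [AddCommGroup N] [Module T N] (s : S)
    (f : L →ₗ[T] N) :
    (isBaseChange_baseChangeHom S L N).equiv (s ⊗ₜ[T] f) = s • f.baseChange S := by
  rw [IsBaseChange.equiv_tmul, LinearMap.baseChangeHom_apply]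

/-! ## (H4) Consequences: finite-sum surjectivity, injectivity of `f ↦ f ⊗ S` -/

/-- **Every `S`-linear map `S ⊗ L → S ⊗ N` is an `S`-combination of base changes** `i ⊗ S` of
`T`-linear maps `i : L → N`, for `S` flat over `T` and `L` finitely presented. [folklore] -/
theorem mem_span_range_baseChange [Module.Flat T S] {L N : Type u} [AddCommGroup L] [Module T L]
    [Module.FinitePresentation T L] [AddCommGroup N] [Module T N]
    (g : S ⊗[T] L →ₗ[S] S ⊗[T] N) :
    g ∈ Submodule.span S (Set.range fun i : L →ₗ[T] N => i.baseChange S) := by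
  obtain ⟨u, hu⟩ := (bijective_liftBaseChange_of_isBaseChange S
    (isBaseChange_baseChangeHom S L N)).2 g
  rw [← hu]
  clear hu
  induction u using TensorProduct.induction_on with
  | zero => simp only [map_zero, Submodule.zero_mem]
  | add u₁ u₂ h₁ h₂ => simpa only [map_add] using Submodule.add_mem _ h₁ h₂
  | tmul s f =>
    rw [LinearMap.liftBaseChange_tmul, LinearMap.baseChangeHom_apply]
    exact Submodule.smul_mem _ s (Submodule.subset_span ⟨f, rfl⟩)

/-- For `S` faithfully flat over `T` (any `L`, `N`): `i ↦ i ⊗ S` is injective on `Hom_T(L, N)` —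
`(i ⊗ S)(1 ⊗ l) = 1 ⊗ i l` and `1 ⊗ (·)` is injective (Mathlib
`Module.FaithfullyFlat.one_tmul_eq_zero_iff`). [folklore] -/
theorem baseChange_injective [Module.FaithfullyFlat T S] {L N : Type u} [AddCommGroup L]
    [Module T L] [AddCommGroup N] [Module T N] :
    Function.Injective fun i : L →ₗ[T] N => i.baseChange S := by
  intro i j h
  ext l
  have h1 := LinearMap.congr_fun h ((1 : S) ⊗ₜ[T] l)
  simp only [LinearMap.baseChange_tmul] at h1
  rw [← sub_eq_zero, ← TensorProduct.tmul_sub, Module.FaithfullyFlat.one_tmul_eq_zero_iff,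
    sub_eq_zero] at h1
  exact h1

end Summit.ResolutionOfSingularities.ResolutionOfSingularities.Theorems.HomologicalConductor.PersistenceFlatHomBaseChange

end
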